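import Mathlib
import Literature.Topology.FourManifolds.PlanarAchiralWords
import Literature.Topology.FourManifolds.PlanarShadowWalk
import Summits.SmoothPoincare4.SmoothPoincare4.Theorems.ConvexBisectionPlanarAcyclicBisectionRigidityHelperWalkThreeDegenerate
import HarnessLib

/-!
# Crux `ConvexBisection.PlanarAcyclicBisectionRigidity`, line Sketch v3.0 — `stub_walk3`, part 3c:
# dispatch of the configurations and the assembly `walk3_of_helpers`

With parts 1–3b in hand: a unimodular block on three holes with equal monodromy to another block is,
by the classification, either GENERIC (`{x,y}`, `{x,z}` or `{y,z}` plus one central letter — the last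
two are turned into `{x,y}` by one global conjugation by `σ₀⁻¹`, resp. `σ₁`, and all three go to
`Walk3.generic_xy` of part 2, whose hypotheses are the faithfulness of the `F₂` shadow `hF` and the
twist-level lift `hL`) or DEGENERATE (at most one two-hole letter; part 3b), the partner block being
put in the same configuration by the type-multiset agreement `hT`.  Main theorem
`Walk3.walk3_of_helpers` (64-way case split), registered as `helper_walk3_ofHelpers`; with the three
registered helpers `helper_shadow_faithful3` (`hF`), `helper_twistLift3` (`hL`), `helper_types_perm3`
(`hT`) it is `stub_walk3` verbatim.
-/

noncomputable section

open Literature.Topology.FourManifolds Literature.Topology.FourManifolds.PlanarWords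
open Literature.Topology.FourManifolds.PlanarShadow (F₂ gx gy IsXYGen shadowWord shadowWord_append
  shadowWord_nil XYPairs)

-- the prescribed namespace `Summit.<S>.<P>.…` repeats `SmoothPoincare4` (S = P = SmoothPoincare4)
set_option linter.dupNamespace false

namespace Summit.SmoothPoincare4.SmoothPoincare4.Theorems.PlanarAcyclicBisectionRigidity.Sketch

namespace Walk3

open ArcData PGen WalkLow SeamNG ReachMon Conj3

set_option quotPrecheck false in
/-- `Central[d]`: the positive twist of `d` is `T_[j,j]` for some `j` or `T_[0,2]`. [folklore] -/
local notation "Central[" d "]" => ((∃ j : Fin 3, T 3 (d, true) = U 3 [PGen.round j.val j.val false]) ∨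
  T 3 (d, true) = U 3 [PGen.round 0 2 false])

set_option quotPrecheck false in
/-- `XYData[c, p]`: the positive twist of `c` evaluates like an XY-word of shadow `p`. [folklore] -/
local notation "XYData[" c ", " p "]" => (∃ g : List PGen, (∀ q ∈ g, IsXYGen q) ∧ shadowWord g = p ∧
  evalWord 3 (PlanarCurve.twistWord c true) = evalWord 3 g)

set_option quotPrecheck false in
/-- `KindX[c]`: `c` has hole type `110` and `x`-data. [folklore] -/
local notation "KindX[" c "]" => (AbArc.typeVec 3 c = ![1, 1, 0] ∧
  ∃ p : F₂, XYData[c, p] ∧ ∃ u : F₂, p = u * gx * u⁻¹)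

set_option quotPrecheck false in
/-- `KindY[c]`: `c` has hole type `011` and `y`-data. [folklore] -/
local notation "KindY[" c "]" => (AbArc.typeVec 3 c = ![0, 1, 1] ∧
  ∃ p : F₂, XYData[c, p] ∧ ∃ u : F₂, p = u * gy * u⁻¹)

set_option quotPrecheck false in
/-- `KindZ[c]`: `c` has hole type `101`. [folklore] -/
local notation "KindZ[" c "]" => (AbArc.typeVec 3 c = ![1, 0, 1])

/-! ## Dispatch lemmas: the generic configurations and the degenerate one, from the roles in `A` -/

/-- **GENERIC `{x, y}` FROM ROLES.**  `A` an arrangement of a central `d`, an `x`-letter `a` and a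
`y`-letter `b`; `B` any block with the same type multiset (`hT`): an honest double is reached.
[folklore] -/
theorem gen_XY (hF : ∀ (g h : List PGen), (∀ q ∈ g, IsXYGen q) → (∀ q ∈ h, IsXYGen q) →
      evalWord 3 g = evalWord 3 h → shadowWord g = shadowWord h)
    (hL : ∀ (dA dB a₁ a₂ b₁ b₂ : PlanarCurve) (w p₁ p₂ q₁ q₂ : F₂),
      evalWord 3 (dA.twistWord true) = evalWord 3 (dB.twistWord true) →
      (p₁, p₂) ∈ XYPairs w → (q₁, q₂) ∈ XYPairs w →
      XYData[a₁, p₁] → XYData[a₂, p₂] → XYData[b₁, q₁] → XYData[b₂, q₂] →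
      ∃ A' B' : List PlanarCurve,
        Reachable (3, blockForm [dA, a₁, a₂] [dB, b₁, b₂]) (3, blockForm A' B') ∧ TwistEq 3 A' B')
    (hT : ∀ (A B : List PlanarCurve), (∀ c ∈ A ++ B, c.InRange 3) → A.length = 3 → B.length = 3 →
      monodromy 3 (positiveWord A) = monodromy 3 (positiveWord B) →
      (A.map (AbArc.typeVec 3)).Perm (B.map (AbArc.typeVec 3)))
    {A B : List PlanarCurve} {d a b : PlanarCurve} (hA : (A = [d, a, b] ∨ A = [d, b, a] ∨ A = [a, d, b] ∨ A = [b, d, a] ∨ A = [a, b, d] ∨ A = [b, a, d]))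
    (hd : Central[d]) (ha : KindX[a]) (hb : KindY[b]) (hin : ∀ c ∈ A ++ B, c.InRange 3)
    (hBl : B.length = 3) (huA : Unimodular 3 A)
    (hmon : monodromy 3 (positiveWord A) = monodromy 3 (positiveWord B)) :
    ∃ A' B' : List PlanarCurve, Reachable (3, blockForm A B) (3, blockForm A' B') ∧ TwistEq 3 A' B' := by
  have hmem := mem_of_arrangement hA
  have hdr : d.InRange 3 := hin d (List.mem_append_left _ hmem.1)
  have har : a.InRange 3 := hin a (List.mem_append_left _ hmem.2.1)
  have hbr : b.InRange 3 := hin b (List.mem_append_left _ hmem.2.2)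
  have hAl : A.length = 3 := (perm_of_arrangement hA).length_eq ▸ rfl
  -- the types of `B` are those of `A`
  obtain ⟨f₁, f₂, f₃, rfl⟩ : ∃ f₁ f₂ f₃, B = [f₁, f₂, f₃] := by
    match B, hBl with | [f₁, f₂, f₃], _ => exact ⟨f₁, f₂, f₃, rfl⟩
  have hperm : List.Perm [AbArc.typeVec 3 d, AbArc.typeVec 3 a, AbArc.typeVec 3 b]
      [AbArc.typeVec 3 f₁, AbArc.typeVec 3 f₂, AbArc.typeVec 3 f₃] := by
    have h := hT A [f₁, f₂, f₃] hin hAl rfl hmon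
    exact ((perm_of_arrangement hA).map (AbArc.typeVec 3)).trans h
  have hne := types_ne_of_unimodular (unimodular_of_perm (perm_of_arrangement hA).symm huA)
  obtain ⟨g₁, g₂, g₃, ht₁, ht₂, ht₃, ⟨hg₁, hg₂, hg₃⟩, hB⟩ :=
    arrange3 f₁ f₂ f₃ _ _ _ hne.1 hne.2.1 hne.2.2 hperm
  have hg₁r : g₁.InRange 3 := hin g₁ (List.mem_append_right _ hg₁)
  have hg₂r : g₂.InRange 3 := hin g₂ (List.mem_append_right _ hg₂)
  have hg₃r : g₃.InRange 3 := hin g₃ (List.mem_append_right _ hg₃)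
  have he : Central[g₁] := central_of_type hg₁r hdr hd ht₁
  have hde : T 3 (d, true) = T 3 (g₁, true) := central_twist_eq_of_type_eq hdr hg₁r hd he ht₁.symm
  obtain ⟨-, qx, hex, hqx⟩ := kindX_of_type hg₂r (ht₂.trans ha.1)
  obtain ⟨-, qy, hey, hqy⟩ := kindY_of_type hg₃r (ht₃.trans hb.1)
  obtain ⟨-, px, hax, hpx⟩ := ha
  obtain ⟨-, py, hby, hpy⟩ := hb
  exact generic_xy hF hL hA hB hd he hde hax hby hex hey hpx hpy hqx hqy hdr har hbr hg₁r hg₂r hg₃r hmon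

/-- **GENERIC `{x, z}` FROM ROLES**: one global conjugation by `σ₀⁻¹` makes it `{x, y}`. [folklore] -/
theorem gen_XZ (hF : ∀ (g h : List PGen), (∀ q ∈ g, IsXYGen q) → (∀ q ∈ h, IsXYGen q) →
      evalWord 3 g = evalWord 3 h → shadowWord g = shadowWord h)
    (hL : ∀ (dA dB a₁ a₂ b₁ b₂ : PlanarCurve) (w p₁ p₂ q₁ q₂ : F₂),
      evalWord 3 (dA.twistWord true) = evalWord 3 (dB.twistWord true) →
      (p₁, p₂) ∈ XYPairs w → (q₁, q₂) ∈ XYPairs w →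
      XYData[a₁, p₁] → XYData[a₂, p₂] → XYData[b₁, q₁] → XYData[b₂, q₂] →
      ∃ A' B' : List PlanarCurve,
        Reachable (3, blockForm [dA, a₁, a₂] [dB, b₁, b₂]) (3, blockForm A' B') ∧ TwistEq 3 A' B')
    (hT : ∀ (A B : List PlanarCurve), (∀ c ∈ A ++ B, c.InRange 3) → A.length = 3 → B.length = 3 →
      monodromy 3 (positiveWord A) = monodromy 3 (positiveWord B) →
      (A.map (AbArc.typeVec 3)).Perm (B.map (AbArc.typeVec 3)))
    {A B : List PlanarCurve} {d a b : PlanarCurve} (hA : (A = [d, a, b] ∨ A = [d, b, a] ∨ A = [a, d, b] ∨ A = [b, d, a] ∨ A = [a, b, d] ∨ A = [b, a, d]))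
    (hd : Central[d]) (ha : KindX[a]) (hb : KindZ[b]) (hin : ∀ c ∈ A ++ B, c.InRange 3)
    (hBl : B.length = 3) (huA : Unimodular 3 A)
    (hmon : monodromy 3 (positiveWord A) = monodromy 3 (positiveWord B)) :
    ∃ A' B' : List PlanarCurve, Reachable (3, blockForm A B) (3, blockForm A' B') ∧ TwistEq 3 A' B' := by
  have hmem := mem_of_arrangement hA
  have hdr : d.InRange 3 := hin d (List.mem_append_left _ hmem.1)
  have har : a.InRange 3 := hin a (List.mem_append_left _ hmem.2.1)
  have hbr : b.InRange 3 := hin b (List.mem_append_left _ hmem.2.2)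
  have hAl : A.length = 3 := (perm_of_arrangement hA).length_eq ▸ rfl
  obtain ⟨f₁, f₂, f₃, rfl⟩ : ∃ f₁ f₂ f₃, B = [f₁, f₂, f₃] := by
    match B, hBl with | [f₁, f₂, f₃], _ => exact ⟨f₁, f₂, f₃, rfl⟩
  have hperm : List.Perm [AbArc.typeVec 3 d, AbArc.typeVec 3 a, AbArc.typeVec 3 b]
      [AbArc.typeVec 3 f₁, AbArc.typeVec 3 f₂, AbArc.typeVec 3 f₃] := by
    have h := hT A [f₁, f₂, f₃] hin hAl rfl hmon
    exact ((perm_of_arrangement hA).map (AbArc.typeVec 3)).trans h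
  have hne := types_ne_of_unimodular (unimodular_of_perm (perm_of_arrangement hA).symm huA)
  obtain ⟨g₁, g₂, g₃, ht₁, ht₂, ht₃, ⟨hg₁, hg₂, hg₃⟩, hB⟩ :=
    arrange3 f₁ f₂ f₃ _ _ _ hne.1 hne.2.1 hne.2.2 hperm
  have hg₁r : g₁.InRange 3 := hin g₁ (List.mem_append_right _ hg₁)
  have hg₂r : g₂.InRange 3 := hin g₂ (List.mem_append_right _ hg₂)
  have hg₃r : g₃.InRange 3 := hin g₃ (List.mem_append_right _ hg₃)
  have he : Central[g₁] := central_of_type hg₁r hdr hd ht₁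
  have hde : T 3 (d, true) = T 3 (g₁, true) := central_twist_eq_of_type_eq hdr hg₁r hd he ht₁.symm
  -- conjugate everything by `σ₀⁻¹`
  set σ : PGen := sigma 0 true with hσ
  have hσb : σ.below 3 = true := rfl
  have hreach := conj_reach [σ] A [f₁, f₂, f₃]
  have hmon' := monodromy_eq_of_reachable hmon hreach
  have hA' := arrangement_map (PlanarCurve.image [σ]) hA
  have hB' := arrangement_map (PlanarCurve.image [σ]) hB
  obtain ⟨-, px, hax, hpx⟩ := kindX_of_type (inRange_image hσb har) ((types_sigma0 true).1 ha.1)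
  obtain ⟨-, py, hby, hpy⟩ := kindY_of_type (inRange_image hσb hbr) ((types_sigma0 true).2 hb)
  obtain ⟨-, qx, hex, hqx⟩ := kindX_of_type (inRange_image hσb hg₂r) ((types_sigma0 true).1 (ht₂.trans ha.1))
  obtain ⟨-, qy, hey, hqy⟩ := kindY_of_type (inRange_image hσb hg₃r) ((types_sigma0 true).2 (ht₃.trans hb))
  obtain ⟨A', B', hr, hte⟩ := generic_xy hF hL hA' hB' (central_image hσb hd) (central_image hσb he)
    (T_image_eq hde) hax hby hex hey hpx hpy hqx hqy (inRange_image hσb hdr) (inRange_image hσb har)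
    (inRange_image hσb hbr) (inRange_image hσb hg₁r) (inRange_image hσb hg₂r) (inRange_image hσb hg₃r)
    (by simpa using hmon')
  exact ⟨A', B', WalkLevel3.reach_trans (by simpa using hreach) hr, hte⟩

/-- **GENERIC `{y, z}` FROM ROLES**: one global conjugation by `σ₁` makes it `{y, x}`. [folklore] -/
theorem gen_YZ (hF : ∀ (g h : List PGen), (∀ q ∈ g, IsXYGen q) → (∀ q ∈ h, IsXYGen q) →
      evalWord 3 g = evalWord 3 h → shadowWord g = shadowWord h)
    (hL : ∀ (dA dB a₁ a₂ b₁ b₂ : PlanarCurve) (w p₁ p₂ q₁ q₂ : F₂),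
      evalWord 3 (dA.twistWord true) = evalWord 3 (dB.twistWord true) →
      (p₁, p₂) ∈ XYPairs w → (q₁, q₂) ∈ XYPairs w →
      XYData[a₁, p₁] → XYData[a₂, p₂] → XYData[b₁, q₁] → XYData[b₂, q₂] →
      ∃ A' B' : List PlanarCurve,
        Reachable (3, blockForm [dA, a₁, a₂] [dB, b₁, b₂]) (3, blockForm A' B') ∧ TwistEq 3 A' B')
    (hT : ∀ (A B : List PlanarCurve), (∀ c ∈ A ++ B, c.InRange 3) → A.length = 3 → B.length = 3 →
      monodromy 3 (positiveWord A) = monodromy 3 (positiveWord B) →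
      (A.map (AbArc.typeVec 3)).Perm (B.map (AbArc.typeVec 3)))
    {A B : List PlanarCurve} {d a b : PlanarCurve} (hA : (A = [d, a, b] ∨ A = [d, b, a] ∨ A = [a, d, b] ∨ A = [b, d, a] ∨ A = [a, b, d] ∨ A = [b, a, d]))
    (hd : Central[d]) (ha : KindY[a]) (hb : KindZ[b]) (hin : ∀ c ∈ A ++ B, c.InRange 3)
    (hBl : B.length = 3) (huA : Unimodular 3 A)
    (hmon : monodromy 3 (positiveWord A) = monodromy 3 (positiveWord B)) :
    ∃ A' B' : List PlanarCurve, Reachable (3, blockForm A B) (3, blockForm A' B') ∧ TwistEq 3 A' B' := by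
  have hmem := mem_of_arrangement hA
  have hdr : d.InRange 3 := hin d (List.mem_append_left _ hmem.1)
  have har : a.InRange 3 := hin a (List.mem_append_left _ hmem.2.1)
  have hbr : b.InRange 3 := hin b (List.mem_append_left _ hmem.2.2)
  have hAl : A.length = 3 := (perm_of_arrangement hA).length_eq ▸ rfl
  obtain ⟨f₁, f₂, f₃, rfl⟩ : ∃ f₁ f₂ f₃, B = [f₁, f₂, f₃] := by
    match B, hBl with | [f₁, f₂, f₃], _ => exact ⟨f₁, f₂, f₃, rfl⟩
  have hperm : List.Perm [AbArc.typeVec 3 d, AbArc.typeVec 3 a, AbArc.typeVec 3 b]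
      [AbArc.typeVec 3 f₁, AbArc.typeVec 3 f₂, AbArc.typeVec 3 f₃] := by
    have h := hT A [f₁, f₂, f₃] hin hAl rfl hmon
    exact ((perm_of_arrangement hA).map (AbArc.typeVec 3)).trans h
  have hne := types_ne_of_unimodular (unimodular_of_perm (perm_of_arrangement hA).symm huA)
  obtain ⟨g₁, g₂, g₃, ht₁, ht₂, ht₃, ⟨hg₁, hg₂, hg₃⟩, hB⟩ :=
    arrange3 f₁ f₂ f₃ _ _ _ hne.1 hne.2.1 hne.2.2 hperm
  have hg₁r : g₁.InRange 3 := hin g₁ (List.mem_append_right _ hg₁)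
  have hg₂r : g₂.InRange 3 := hin g₂ (List.mem_append_right _ hg₂)
  have hg₃r : g₃.InRange 3 := hin g₃ (List.mem_append_right _ hg₃)
  have he : Central[g₁] := central_of_type hg₁r hdr hd ht₁
  have hde : T 3 (d, true) = T 3 (g₁, true) := central_twist_eq_of_type_eq hdr hg₁r hd he ht₁.symm
  set σ : PGen := sigma 1 false with hσ
  have hσb : σ.below 3 = true := rfl
  have hreach := conj_reach [σ] A [f₁, f₂, f₃]
  have hmon' := monodromy_eq_of_reachable hmon hreach
  -- after `σ₁`: `a ↦ y`-letter, `b ↦ x`-letter; the roles `(d, x, y)` are `(d°, b°, a°)`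
  have hA' : ((A.map (PlanarCurve.image [σ])) = [(PlanarCurve.image [σ] d), (PlanarCurve.image [σ] b), (PlanarCurve.image [σ] a)] ∨ (A.map (PlanarCurve.image [σ])) = [(PlanarCurve.image [σ] d), (PlanarCurve.image [σ] a), (PlanarCurve.image [σ] b)] ∨ (A.map (PlanarCurve.image [σ])) = [(PlanarCurve.image [σ] b), (PlanarCurve.image [σ] d), (PlanarCurve.image [σ] a)] ∨ (A.map (PlanarCurve.image [σ])) = [(PlanarCurve.image [σ] a), (PlanarCurve.image [σ] d), (PlanarCurve.image [σ] b)] ∨ (A.map (PlanarCurve.image [σ])) = [(PlanarCurve.image [σ] b), (PlanarCurve.image [σ] a), (PlanarCurve.image [σ] d)] ∨ (A.map (PlanarCurve.image [σ])) = [(PlanarCurve.image [σ] a), (PlanarCurve.image [σ] b), (PlanarCurve.image [σ] d)]) := by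
    rcases arrangement_map (PlanarCurve.image [σ]) hA with h | h | h | h | h | h
    · exact Or.inr (Or.inl h)
    · exact Or.inl h
    · exact Or.inr (Or.inr (Or.inr (Or.inl h)))
    · exact Or.inr (Or.inr (Or.inl h))
    · exact Or.inr (Or.inr (Or.inr (Or.inr (Or.inr h))))
    · exact Or.inr (Or.inr (Or.inr (Or.inr (Or.inl h))))
  have hB' : (([f₁, f₂, f₃].map (PlanarCurve.image [σ])) = [(PlanarCurve.image [σ] g₁), (PlanarCurve.image [σ] g₃), (PlanarCurve.image [σ] g₂)] ∨ ([f₁, f₂, f₃].map (PlanarCurve.image [σ])) = [(PlanarCurve.image [σ] g₁), (PlanarCurve.image [σ] g₂), (PlanarCurve.image [σ] g₃)] ∨ ([f₁, f₂, f₃].map (PlanarCurve.image [σ])) = [(PlanarCurve.image [σ] g₃), (PlanarCurve.image [σ] g₁), (PlanarCurve.image [σ] g₂)] ∨ ([f₁, f₂, f₃].map (PlanarCurve.image [σ])) = [(PlanarCurve.image [σ] g₂), (PlanarCurve.image [σ] g₁), (PlanarCurve.image [σ] g₃)] ∨ ([f₁, f₂, f₃].map (PlanarCurve.image [σ])) =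 [(PlanarCurve.image [σ] g₃), (PlanarCurve.image [σ] g₂), (PlanarCurve.image [σ] g₁)] ∨ ([f₁, f₂, f₃].map (PlanarCurve.image [σ])) = [(PlanarCurve.image [σ] g₂), (PlanarCurve.image [σ] g₃), (PlanarCurve.image [σ] g₁)]) := by
    rcases arrangement_map (PlanarCurve.image [σ]) hB with h | h | h | h | h | h
    · exact Or.inr (Or.inl h)
    · exact Or.inl h
    · exact Or.inr (Or.inr (Or.inr (Or.inl h)))
    · exact Or.inr (Or.inr (Or.inl h))
    · exact Or.inr (Or.inr (Or.inr (Or.inr (Or.inr h))))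
    · exact Or.inr (Or.inr (Or.inr (Or.inr (Or.inl h))))
  obtain ⟨-, py, hay, hpy⟩ := kindY_of_type (inRange_image hσb har) ((types_sigma1 false).1 ha.1)
  obtain ⟨-, px, hbx, hpx⟩ := kindX_of_type (inRange_image hσb hbr) ((types_sigma1 false).2 hb)
  obtain ⟨-, qy, hey, hqy⟩ := kindY_of_type (inRange_image hσb hg₂r) ((types_sigma1 false).1 (ht₂.trans ha.1))
  obtain ⟨-, qx, hex, hqx⟩ := kindX_of_type (inRange_image hσb hg₃r) ((types_sigma1 false).2 (ht₃.trans hb))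
  obtain ⟨A', B', hr, hte⟩ := generic_xy hF hL hA' hB' (central_image hσb hd) (central_image hσb he)
    (T_image_eq hde) hbx hay hex hey hpx hpy hqx hqy (inRange_image hσb hdr) (inRange_image hσb hbr)
    (inRange_image hσb har) (inRange_image hσb hg₁r) (inRange_image hσb hg₃r) (inRange_image hσb hg₂r)
    (by simpa using hmon')
  exact ⟨A', B', WalkLevel3.reach_trans (by simpa using hreach) hr, hte⟩

/-- **DEGENERATE FROM ROLES.**  `A` an arrangement of two central letters `u`, `v` and any `κ`; `B`
any block with the same type multiset: an honest double is reached. [folklore] -/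
theorem degen (hT : ∀ (A B : List PlanarCurve), (∀ c ∈ A ++ B, c.InRange 3) → A.length = 3 → B.length = 3 →
      monodromy 3 (positiveWord A) = monodromy 3 (positiveWord B) →
      (A.map (AbArc.typeVec 3)).Perm (B.map (AbArc.typeVec 3)))
    {A B : List PlanarCurve} {u v κ : PlanarCurve} (hA : (A = [u, v, κ] ∨ A = [u, κ, v] ∨ A = [v, u, κ] ∨ A = [κ, u, v] ∨ A = [v, κ, u] ∨ A = [κ, v, u]))
    (hu : Central[u]) (hv : Central[v]) (hin : ∀ c ∈ A ++ B, c.InRange 3)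
    (hBl : B.length = 3) (huA : Unimodular 3 A)
    (hmon : monodromy 3 (positiveWord A) = monodromy 3 (positiveWord B)) :
    ∃ A' B' : List PlanarCurve, Reachable (3, blockForm A B) (3, blockForm A' B') ∧ TwistEq 3 A' B' := by
  have hmem := mem_of_arrangement hA
  have hur : u.InRange 3 := hin u (List.mem_append_left _ hmem.1)
  have hvr : v.InRange 3 := hin v (List.mem_append_left _ hmem.2.1)
  have hκr : κ.InRange 3 := hin κ (List.mem_append_left _ hmem.2.2)
  have hAl : A.length = 3 := (perm_of_arrangement hA).length_eq ▸ rfl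
  obtain ⟨f₁, f₂, f₃, rfl⟩ : ∃ f₁ f₂ f₃, B = [f₁, f₂, f₃] := by
    match B, hBl with | [f₁, f₂, f₃], _ => exact ⟨f₁, f₂, f₃, rfl⟩
  have hperm : List.Perm [AbArc.typeVec 3 u, AbArc.typeVec 3 v, AbArc.typeVec 3 κ]
      [AbArc.typeVec 3 f₁, AbArc.typeVec 3 f₂, AbArc.typeVec 3 f₃] := by
    have h := hT A [f₁, f₂, f₃] hin hAl rfl hmon
    exact ((perm_of_arrangement hA).map (AbArc.typeVec 3)).trans h
  have hne := types_ne_of_unimodular (unimodular_of_perm (perm_of_arrangement hA).symm huA)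
  obtain ⟨g₁, g₂, g₃, ht₁, ht₂, ht₃, ⟨hg₁, hg₂, hg₃⟩, hB⟩ :=
    arrange3 f₁ f₂ f₃ _ _ _ hne.1 hne.2.1 hne.2.2 hperm
  have hg₁r : g₁.InRange 3 := hin g₁ (List.mem_append_right _ hg₁)
  have hg₂r : g₂.InRange 3 := hin g₂ (List.mem_append_right _ hg₂)
  have hg₃r : g₃.InRange 3 := hin g₃ (List.mem_append_right _ hg₃)
  have hu₂ : Central[g₁] := central_of_type hg₁r hur hu ht₁
  have hv₂ : Central[g₂] := central_of_type hg₂r hvr hv ht₂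
  exact degenerate hA hB hu hv hu₂ hv₂ (central_twist_eq_of_type_eq hur hg₁r hu hu₂ ht₁.symm)
    (central_twist_eq_of_type_eq hvr hg₂r hv hv₂ ht₂.symm) hur hvr hκr hg₁r hg₂r hg₃r hmon

/-! ## The assembly -/

/-- **`stub_walk3` FROM THE THREE REGISTERED HELPERS.**  Every integral homotopy-sphere word on
three holes — in ANY spelling — walks to an honest double at level `3`, given: faithfulness of the
`F₂` shadow (`hF` = `helper_shadow_faithful3`), the twist-level lift of the lever
(`hL` = `helper_twistLift3`), and the agreement of type multisets (`hT` = `helper_types_perm3`).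
Classify the three letters of `A` (central / `x` / `y` / `z`); unimodularity excludes repeated types
and the configuration `{x, y, z}`; two two-hole letters are the generic configurations (`gen_XY`,
`gen_XZ`, `gen_YZ`), at most one is the degenerate one (`degen`). [folklore] -/
theorem walk3_of_helpers (hF : ∀ (g h : List PGen), (∀ q ∈ g, IsXYGen q) → (∀ q ∈ h, IsXYGen q) →
      evalWord 3 g = evalWord 3 h → shadowWord g = shadowWord h)
    (hL : ∀ (dA dB a₁ a₂ b₁ b₂ : PlanarCurve) (w p₁ p₂ q₁ q₂ : F₂),
      evalWord 3 (dA.twistWord true) = evalWord 3 (dB.twistWord true) →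
      (p₁, p₂) ∈ XYPairs w → (q₁, q₂) ∈ XYPairs w →
      XYData[a₁, p₁] → XYData[a₂, p₂] → XYData[b₁, q₁] → XYData[b₂, q₂] →
      ∃ A' B' : List PlanarCurve,
        Reachable (3, blockForm [dA, a₁, a₂] [dB, b₁, b₂]) (3, blockForm A' B') ∧ TwistEq 3 A' B')
    (hT : ∀ (A B : List PlanarCurve), (∀ c ∈ A ++ B, c.InRange 3) → A.length = 3 → B.length = 3 →
      monodromy 3 (positiveWord A) = monodromy 3 (positiveWord B) →
      (A.map (AbArc.typeVec 3)).Perm (B.map (AbArc.typeVec 3)))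
    (A B : List PlanarCurve) (hw : IsIntegralSphereWord 3 A B) :
    ∃ A' B' : List PlanarCurve, Reachable (3, blockForm A B) (3, blockForm A' B') ∧ TwistEq 3 A' B' := by
  obtain ⟨hin, hAl, hBl, hmon, -, huA, -⟩ := hw
  obtain ⟨c₁, c₂, c₃, rfl⟩ : ∃ c₁ c₂ c₃, A = [c₁, c₂, c₃] := by
    match A, hAl with | [c₁, c₂, c₃], _ => exact ⟨c₁, c₂, c₃, rfl⟩
  have h1 : c₁.InRange 3 := hin c₁ (by simp)
  have h2 : c₂.InRange 3 := hin c₂ (by simp)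
  have h3 : c₃.InRange 3 := hin c₃ (by simp)
  have hne := types_ne_of_unimodular huA
  rcases classify h1 with C1 | X1 | Y1 | Z1
  · rcases classify h2 with C2 | X2 | Y2 | Z2
    · rcases classify h3 with C3 | X3 | Y3 | Z3
      · exact degen hT (A := [c₁, c₂, c₃]) (u := c₁) (v := c₂) (κ := c₃) (Or.inl rfl) C1 C2 hin hBl huA hmon
      · exact degen hT (A := [c₁, c₂, c₃]) (u := c₁) (v := c₂) (κ := c₃) (Or.inl rfl) C1 C2 hin hBl huA hmon
      · exact degen hT (A := [c₁, c₂, c₃]) (u := c₁) (v := c₂) (κ := c₃) (Or.inl rfl) C1 C2 hin hBl huA hmon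
      · exact degen hT (A := [c₁, c₂, c₃]) (u := c₁) (v := c₂) (κ := c₃) (Or.inl rfl) C1 C2 hin hBl huA hmon
    · rcases classify h3 with C3 | X3 | Y3 | Z3
      · exact degen hT (A := [c₁, c₂, c₃]) (u := c₁) (v := c₃) (κ := c₂) (Or.inr (Or.inl rfl)) C1 C3 hin hBl huA hmon
      · exact absurd ((X2.1).trans (X3.1).symm) hne.2.2
      · exact gen_XY hF hL hT (A := [c₁, c₂, c₃]) (d := c₁) (a := c₂) (b := c₃) (Or.inl rfl) C1 X2 Y3 hin hBl huA hmon
      · exact gen_XZ hF hL hT (A := [c₁, c₂, c₃]) (d := c₁) (a := c₂) (b := c₃) (Or.inl rfl) C1 X2 Z3 hin hBl huA hmon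
    · rcases classify h3 with C3 | X3 | Y3 | Z3
      · exact degen hT (A := [c₁, c₂, c₃]) (u := c₁) (v := c₃) (κ := c₂) (Or.inr (Or.inl rfl)) C1 C3 hin hBl huA hmon
      · exact gen_XY hF hL hT (A := [c₁, c₂, c₃]) (d := c₁) (a := c₃) (b := c₂) (Or.inr (Or.inl rfl)) C1 X3 Y2 hin hBl huA hmon
      · exact absurd ((Y2.1).trans (Y3.1).symm) hne.2.2
      · exact gen_YZ hF hL hT (A := [c₁, c₂, c₃]) (d := c₁) (a := c₂) (b := c₃) (Or.inl rfl) C1 Y2 Z3 hin hBl huA hmon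
    · rcases classify h3 with C3 | X3 | Y3 | Z3
      · exact degen hT (A := [c₁, c₂, c₃]) (u := c₁) (v := c₃) (κ := c₂) (Or.inr (Or.inl rfl)) C1 C3 hin hBl huA hmon
      · exact gen_XZ hF hL hT (A := [c₁, c₂, c₃]) (d := c₁) (a := c₃) (b := c₂) (Or.inr (Or.inl rfl)) C1 X3 Z2 hin hBl huA hmon
      · exact gen_YZ hF hL hT (A := [c₁, c₂, c₃]) (d := c₁) (a := c₃) (b := c₂) (Or.inr (Or.inl rfl)) C1 Y3 Z2 hin hBl huA hmon
      · exact absurd ((Z2).trans (Z3).symm) hne.2.2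
  · rcases classify h2 with C2 | X2 | Y2 | Z2
    · rcases classify h3 with C3 | X3 | Y3 | Z3
      · exact degen hT (A := [c₁, c₂, c₃]) (u := c₂) (v := c₃) (κ := c₁) (Or.inr (Or.inr (Or.inr (Or.inl rfl)))) C2 C3 hin hBl huA hmon
      · exact absurd ((X1.1).trans (X3.1).symm) hne.2.1
      · exact gen_XY hF hL hT (A := [c₁, c₂, c₃]) (d := c₂) (a := c₁) (b := c₃) (Or.inr (Or.inr (Or.inl rfl))) C2 X1 Y3 hin hBl huA hmon
      · exact gen_XZ hF hL hT (A := [c₁, c₂, c₃]) (d := c₂) (a := c₁) (b := c₃) (Or.inr (Or.inr (Or.inl rfl))) C2 X1 Z3 hin hBl huA hmon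
    · rcases classify h3 with C3 | X3 | Y3 | Z3
      · exact absurd ((X1.1).trans (X2.1).symm) hne.1
      · exact absurd ((X1.1).trans (X2.1).symm) hne.1
      · exact absurd ((X1.1).trans (X2.1).symm) hne.1
      · exact absurd ((X1.1).trans (X2.1).symm) hne.1
    · rcases classify h3 with C3 | X3 | Y3 | Z3
      · exact gen_XY hF hL hT (A := [c₁, c₂, c₃]) (d := c₃) (a := c₁) (b := c₂) (Or.inr (Or.inr (Or.inr (Or.inr (Or.inl rfl))))) C3 X1 Y2 hin hBl huA hmon
      · exact absurd ((X1.1).trans (X3.1).symm) hne.2.1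
      · exact absurd ((Y2.1).trans (Y3.1).symm) hne.2.2
      · exact (not_xyz_of_unimodular huA (Or.inl X1.1) (Or.inr (Or.inl Y2.1)) (Or.inr (Or.inr Z3))).elim
    · rcases classify h3 with C3 | X3 | Y3 | Z3
      · exact gen_XZ hF hL hT (A := [c₁, c₂, c₃]) (d := c₃) (a := c₁) (b := c₂) (Or.inr (Or.inr (Or.inr (Or.inr (Or.inl rfl))))) C3 X1 Z2 hin hBl huA hmon
      · exact absurd ((X1.1).trans (X3.1).symm) hne.2.1
      · exact (not_xyz_of_unimodular huA (Or.inl X1.1) (Or.inr (Or.inr Z2)) (Or.inr (Or.inl Y3.1))).elim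
      · exact absurd ((Z2).trans (Z3).symm) hne.2.2
  · rcases classify h2 with C2 | X2 | Y2 | Z2
    · rcases classify h3 with C3 | X3 | Y3 | Z3
      · exact degen hT (A := [c₁, c₂, c₃]) (u := c₂) (v := c₃) (κ := c₁) (Or.inr (Or.inr (Or.inr (Or.inl rfl)))) C2 C3 hin hBl huA hmon
      · exact gen_XY hF hL hT (A := [c₁, c₂, c₃]) (d := c₂) (a := c₃) (b := c₁) (Or.inr (Or.inr (Or.inr (Or.inl rfl)))) C2 X3 Y1 hin hBl huA hmon
      · exact absurd ((Y1.1).trans (Y3.1).symm) hne.2.1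
      · exact gen_YZ hF hL hT (A := [c₁, c₂, c₃]) (d := c₂) (a := c₁) (b := c₃) (Or.inr (Or.inr (Or.inl rfl))) C2 Y1 Z3 hin hBl huA hmon
    · rcases classify h3 with C3 | X3 | Y3 | Z3
      · exact gen_XY hF hL hT (A := [c₁, c₂, c₃]) (d := c₃) (a := c₂) (b := c₁) (Or.inr (Or.inr (Or.inr (Or.inr (Or.inr rfl))))) C3 X2 Y1 hin hBl huA hmon
      · exact absurd ((X2.1).trans (X3.1).symm) hne.2.2
      · exact absurd ((Y1.1).trans (Y3.1).symm) hne.2.1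
      · exact (not_xyz_of_unimodular huA (Or.inr (Or.inl Y1.1)) (Or.inl X2.1) (Or.inr (Or.inr Z3))).elim
    · rcases classify h3 with C3 | X3 | Y3 | Z3
      · exact absurd ((Y1.1).trans (Y2.1).symm) hne.1
      · exact absurd ((Y1.1).trans (Y2.1).symm) hne.1
      · exact absurd ((Y1.1).trans (Y2.1).symm) hne.1
      · exact absurd ((Y1.1).trans (Y2.1).symm) hne.1
    · rcases classify h3 with C3 | X3 | Y3 | Z3
      · exact gen_YZ hF hL hT (A := [c₁, c₂, c₃]) (d := c₃) (a := c₁) (b := c₂) (Or.inr (Or.inr (Or.inr (Or.inr (Or.inl rfl))))) C3 Y1 Z2 hin hBl huA hmon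
      · exact (not_xyz_of_unimodular huA (Or.inr (Or.inl Y1.1)) (Or.inr (Or.inr Z2)) (Or.inl X3.1)).elim
      · exact absurd ((Y1.1).trans (Y3.1).symm) hne.2.1
      · exact absurd ((Z2).trans (Z3).symm) hne.2.2
  · rcases classify h2 with C2 | X2 | Y2 | Z2
    · rcases classify h3 with C3 | X3 | Y3 | Z3
      · exact degen hT (A := [c₁, c₂, c₃]) (u := c₂) (v := c₃) (κ := c₁) (Or.inr (Or.inr (Or.inr (Or.inl rfl)))) C2 C3 hin hBl huA hmon
      · exact gen_XZ hF hL hT (A := [c₁, c₂, c₃]) (d := c₂) (a := c₃) (b := c₁) (Or.inr (Or.inr (Or.inr (Or.inl rfl)))) C2 X3 Z1 hin hBl huA hmon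
      · exact gen_YZ hF hL hT (A := [c₁, c₂, c₃]) (d := c₂) (a := c₃) (b := c₁) (Or.inr (Or.inr (Or.inr (Or.inl rfl)))) C2 Y3 Z1 hin hBl huA hmon
      · exact absurd ((Z1).trans (Z3).symm) hne.2.1
    · rcases classify h3 with C3 | X3 | Y3 | Z3
      · exact gen_XZ hF hL hT (A := [c₁, c₂, c₃]) (d := c₃) (a := c₂) (b := c₁) (Or.inr (Or.inr (Or.inr (Or.inr (Or.inr rfl))))) C3 X2 Z1 hin hBl huA hmon
      · exact absurd ((X2.1).trans (X3.1).symm) hne.2.2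
      · exact (not_xyz_of_unimodular huA (Or.inr (Or.inr Z1)) (Or.inl X2.1) (Or.inr (Or.inl Y3.1))).elim
      · exact absurd ((Z1).trans (Z3).symm) hne.2.1
    · rcases classify h3 with C3 | X3 | Y3 | Z3
      · exact gen_YZ hF hL hT (A := [c₁, c₂, c₃]) (d := c₃) (a := c₂) (b := c₁) (Or.inr (Or.inr (Or.inr (Or.inr (Or.inr rfl))))) C3 Y2 Z1 hin hBl huA hmon
      · exact (not_xyz_of_unimodular huA (Or.inr (Or.inr Z1)) (Or.inr (Or.inl Y2.1)) (Or.inl X3.1)).elim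
      · exact absurd ((Y2.1).trans (Y3.1).symm) hne.2.2
      · exact absurd ((Z1).trans (Z3).symm) hne.2.1
    · rcases classify h3 with C3 | X3 | Y3 | Z3
      · exact absurd ((Z1).trans (Z2).symm) hne.1
      · exact absurd ((Z1).trans (Z2).symm) hne.1
      · exact absurd ((Z1).trans (Z2).symm) hne.1
      · exact absurd ((Z1).trans (Z2).symm) hne.1

end Walk3

open ReachMon in
/-- **Registered helper `helper_walk3_ofHelpers`** (= `Walk3.walk3_of_helpers`, notations expanded):
`stub_walk3` from the three registered analytic helpers `helper_shadow_faithful3` (`hF`),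
`helper_twistLift3` (`hL`) and `helper_types_perm3` (`hT`). [folklore] -/
theorem helper_walk3_ofHelpers (hF : ∀ (g h : List PGen), (∀ q ∈ g, IsXYGen q) → (∀ q ∈ h, IsXYGen q) → evalWord 3 g = evalWord 3 h → shadowWord g = shadowWord h) (hL : ∀ (dA dB a₁ a₂ b₁ b₂ : PlanarCurve) (w p₁ p₂ q₁ q₂ : F₂), evalWord 3 (dA.twistWord true) = evalWord 3 (dB.twistWord true) → (p₁, p₂) ∈ XYPairs w → (q₁, q₂) ∈ XYPairs w → (∃ g : List PGen, (∀ q ∈ g, IsXYGen q) ∧ shadowWord g = p₁ ∧ evalWord 3 (PlanarCurve.twistWord a₁ true) = evalWord 3 g) → (∃ g : List PGen, (∀ q ∈ g, IsXYGen q) ∧ shadowWord g = p₂ ∧ evalWord 3 (PlanarCurve.twistWord a₂ true) = evalWord 3 g) → (∃ g : List PGen, (∀ q ∈ g, IsXYGen q) ∧ shadowWord g = q₁ ∧ evalWord 3 (PlanarCurve.twistWord b₁ true) = evalWord 3 g) → (∃ g : List PGen, (∀ q ∈ g, IsXYGen q) ∧ shadowWord g = q₂ ∧ evalWord 3 (PlanarCurve.twistWord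 b₂ true) = evalWord 3 g) → ∃ A' B' : List PlanarCurve, Reachable (3, blockForm [dA, a₁, a₂] [dB, b₁, b₂]) (3, blockForm A' B') ∧ TwistEq 3 A' B') (hT : ∀ (A B : List PlanarCurve), (∀ c ∈ A ++ B, c.InRange 3) → A.length = 3 → B.length = 3 → monodromy 3 (positiveWord A) = monodromy 3 (positiveWord B) → (A.map (AbArc.typeVec 3)).Perm (B.map (AbArc.typeVec 3))) (A B : List PlanarCurve) (hw : IsIntegralSphereWord 3 A B) : ∃ A' B' : List PlanarCurve, Reachable (3, blockForm A B) (3, blockForm A' B') ∧ TwistEq 3 A' B' :=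
  Walk3.walk3_of_helpers hF hL hT A B hw

end Summit.SmoothPoincare4.SmoothPoincare4.Theorems.PlanarAcyclicBisectionRigidity.Sketch

end
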